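import Summits.QuantumFields.QCD.Theorems.QuarksAsStableActionCriticalLineDiamagnetismCellKappaSoundB

/-!
# Cell-pressure certificate — soundness layer C: bounds, the bubble sum, the box cover
(crux stmt-QuantumFields-9734, line `Sketch`, stub `stub_heavyFrequencyGain`, Route B step B6; lead c3)

* `absUpper_sound`: `‖z‖·S ≤ CA.absUpper F` for `z ∈ F` (`|re|, |im| ≤ |c| + rad`, `√n < Nat.sqrt n + 1`);
* `applyBlock_sound`: the hop blocks `g ↦ g (±P∓²)`; `linkBlocks_eq` (the real-side blocks are the encoded ones);
* `boundsOnBox_sound`: on a sub-box, `κlo ≤ κ₁,J · S` and `b_{J,R} · 4S ≤ bhi` (term-by-term comparison of the two nested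
  list sums, the table lookups staying in the sound region `max(|a|,|b|) ≤ R + 1`);
* `boxVar_sound`, `cover_index`: every point of the heavy box lies in a listed sub-box with valid noise values;
* `cellKappaCheck_sound` and **`cellKappaClaim_of_check`** (registered): `cellKappaCheck S K 14 7 nM ns = true → CellKappaClaim`.
-/

open Literature.Analysis.ValidatedNumerics
open Literature.MathematicalPhysics.QuantumLattice

namespace Summit.QuantumFields.QCD.Cruxes.CriticalLineDiamagnetism.ChessboardCellGain.CellKappa

variable {S : ℕ} {ε : ℕ → ℝ}

/-! ### Absolute values -/

/-- The scaled modulus of an enclosed complex number is below `CA.absUpper`. -/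
theorem absUpper_sound (hε : AForm.Valid ε) {z : ℂ} {F : CA} (hz : CA.mem S ε z F) :
    ‖z‖ * S ≤ (CA.absUpper F : ℝ) := by
  unfold CA.absUpper
  simp only
  set u : ℕ := F.re.c.natAbs + F.re.rad with hu_def
  set v : ℕ := F.im.c.natAbs + F.im.rad with hv_def
  have hre := AForm.abs_sub_le_rad hε hz.1
  have him := AForm.abs_sub_le_rad hε hz.2
  have hu : |z.re * S| ≤ (u : ℝ) := by
    calc |z.re * S| = |(z.re * S - F.re.c) + F.re.c| := by rw [sub_add_cancel]
      _ ≤ |z.re * S - F.re.c| + |(F.re.c : ℝ)| := abs_add_le _ _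
      _ ≤ AForm.rad F.re + |(F.re.c : ℝ)| := by gcongr
      _ = (u : ℝ) := by rw [hu_def]; push_cast [Nat.cast_natAbs]; ring
  have hv : |z.im * S| ≤ (v : ℝ) := by
    calc |z.im * S| = |(z.im * S - F.im.c) + F.im.c| := by rw [sub_add_cancel]
      _ ≤ |z.im * S - F.im.c| + |(F.im.c : ℝ)| := abs_add_le _ _
      _ ≤ AForm.rad F.im + |(F.im.c : ℝ)| := by gcongr
      _ = (v : ℝ) := by rw [hv_def]; push_cast [Nat.cast_natAbs]; ring
  have h2 : (‖z‖ * S) ^ 2 ≤ (u : ℝ) ^ 2 + (v : ℝ) ^ 2 := by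
    have e : (‖z‖ * S) ^ 2 = (z.re * S) ^ 2 + (z.im * S) ^ 2 := by
      rw [mul_pow, Complex.sq_norm, Complex.normSq_apply]; ring
    rw [e, ← sq_abs (z.re * S), ← sq_abs (z.im * S)]
    gcongr
  have h3 : (u : ℝ) ^ 2 + (v : ℝ) ^ 2 < ((Nat.sqrt (u * u + v * v) + 1 : ℕ) : ℝ) ^ 2 := by
    have h := Nat.lt_succ_sqrt' (u * u + v * v)
    have h' : ((u * u + v * v : ℕ) : ℝ) < (((Nat.sqrt (u * u + v * v)).succ ^ 2 : ℕ) : ℝ) := by exact_mod_cast h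
    convert h' using 1 <;> push_cast <;> ring
  exact (lt_of_pow_lt_pow_left₀ 2 (by positivity) (h2.trans_lt h3)).le

/-! ### Hop blocks -/

/-- `g ↦ g (σ P₋²)` is enclosed by `applyBlock · σ true`. -/
theorem applyBlock_sound_true (hε : AForm.Valid ε) {g : Matrix (Fin 4) (Fin 4) ℂ} {G : CM} (hg : CM.mem S ε g G)
    (σ : ℤ) : CM.mem S ε (g * ((σ : ℂ) • pMinus 2)) (applyBlock G σ true) := by
  have hT : ∀ i j : Fin 4, ((σ : ℂ) • ((1 : Matrix (Fin 4) (Fin 4) ℂ) - euclideanGamma 2)) i j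
      = (((σ * (twoPMinusTab 2 i j).1 : ℤ)) : ℂ) + ((σ * (twoPMinusTab 2 i j).2 : ℤ) : ℂ) * Complex.I := by
    intro i j
    rw [Matrix.smul_apply, twoPMinusTab_spec, smul_eq_mul]
    change (σ : ℂ) * (((twoPMinusTab 2 i j).1 : ℂ) + ((twoPMinusTab 2 i j).2 : ℂ) * Complex.I) = _
    push_cast
    ring
  have h := CM.mem_half hε (CM.mem_gmulRight
    (g := fun i j : ℕ => (σ * (twoPMinusTab 2 i j).1, σ * (twoPMinusTab 2 i j).2)) hT hg)
  have e : g * ((σ : ℂ) • pMinus 2) =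
      (1 / 2 : ℂ) • (g * ((σ : ℂ) • ((1 : Matrix (Fin 4) (Fin 4) ℂ) - euclideanGamma 2))) := by
    rw [pMinus, smul_comm, Matrix.mul_smul]
  rw [e]
  exact h

/-- `g ↦ g (σ P₊²)` is enclosed by `applyBlock · σ false`. -/
theorem applyBlock_sound_false (hε : AForm.Valid ε) {g : Matrix (Fin 4) (Fin 4) ℂ} {G : CM} (hg : CM.mem S ε g G)
    (σ : ℤ) : CM.mem S ε (g * ((σ : ℂ) • pPlus 2)) (applyBlock G σ false) := by
  have hT : ∀ i j : Fin 4, ((σ : ℂ) • ((1 : Matrix (Fin 4) (Fin 4) ℂ) + euclideanGamma 2)) i j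
      = (((σ * (twoPPlusTab 2 i j).1 : ℤ)) : ℂ) + ((σ * (twoPPlusTab 2 i j).2 : ℤ) : ℂ) * Complex.I := by
    intro i j
    rw [Matrix.smul_apply, twoPPlusTab_spec, smul_eq_mul]
    change (σ : ℂ) * (((twoPPlusTab 2 i j).1 : ℂ) + ((twoPPlusTab 2 i j).2 : ℂ) * Complex.I) = _
    push_cast
    ring
  have h := CM.mem_half hε (CM.mem_gmulRight
    (g := fun i j : ℕ => (σ * (twoPPlusTab 2 i j).1, σ * (twoPPlusTab 2 i j).2)) hT hg)
  have e : g * ((σ : ℂ) • pPlus 2) =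
      (1 / 2 : ℂ) • (g * ((σ : ℂ) • ((1 : Matrix (Fin 4) (Fin 4) ℂ) + euclideanGamma 2))) := by
    rw [pPlus, smul_comm, Matrix.mul_smul]
  rw [e]
  exact h

/-- Soundness of `applyBlock` for an encoded block `(σ, isMinus)`. -/
theorem applyBlock_sound (hε : AForm.Valid ε) {g : Matrix (Fin 4) (Fin 4) ℂ} {G : CM} (hg : CM.mem S ε g G)
    (σ : ℤ) : ∀ m : Bool, CM.mem S ε (g * ((σ : ℂ) • (if m then pMinus 2 else pPlus 2))) (applyBlock G σ m)
  | true => by simpa using applyBlock_sound_true hε hg σ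
  | false => by simpa using applyBlock_sound_false hε hg σ

/-- The real-side hop blocks are the encoded ones with matrix `σ P∓²`. -/
theorem linkBlocks_eq (l : ℤ × ℤ) : linkBlocks l =
    (linkBlocksE l).map fun b => (b.1, b.2.1, ((b.2.2.1 : ℤ) : ℂ) • (if b.2.2.2 then pMinus 2 else pPlus 2)) := by
  unfold linkBlocks linkBlocksE
  by_cases h : l.1 % 2 = 0 <;> simp [h]

/-- The two enumerations of the partner links coincide. -/
theorem nearLinks_eq : nearLinks = nearLinksE := rfl

/-- Positions of an encoded block of the link based at `l`: `l` or `l + e₂`. -/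
theorem mem_linkBlocksE {l : ℤ × ℤ} {b : (ℤ × ℤ) × (ℤ × ℤ) × ℤ × Bool} (hb : b ∈ linkBlocksE l) :
    l.1 ≤ b.1.1 ∧ b.1.1 ≤ l.1 + 1 ∧ b.1.2 = l.2 ∧ l.1 ≤ b.2.1.1 ∧ b.2.1.1 ≤ l.1 + 1 ∧ b.2.1.2 = l.2 := by
  unfold linkBlocksE at hb
  simp only [List.mem_cons, List.not_mem_nil, or_false] at hb
  rcases hb with rfl | rfl <;> simp

/-- Partner links are within `ℓ¹`-distance `R`. -/
theorem mem_nearLinksE {R : ℕ} {l l' : ℤ × ℤ} (h : l' ∈ nearLinksE R l) : |l'.1 - l.1| + |l'.2 - l.2| ≤ R := by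
  unfold nearLinksE at h
  simp only [List.mem_flatMap, List.mem_filterMap, Option.ite_none_right_eq_some, Option.some.injEq] at h
  obtain ⟨i, -, k, -, ⟨-, hd⟩, rfl⟩ := h
  exact hd

/-! ### Sums -/

/-- Term-by-term comparison of a real list sum (times `c`) with a natural-number list sum. -/
theorem sum_mul_le_natSum {ι : Type*} (l : List ι) (f : ι → ℝ) (g : ι → ℕ) (c : ℝ)
    (h : ∀ x ∈ l, f x * c ≤ g x) : (l.map f).sum * c ≤ ((l.map g).sum : ℕ) := by
  rw [← List.sum_map_mul_right, Nat.cast_list_sum, List.map_map]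
  exact List.sum_le_sum fun x hx => by simpa using h x hx

/-! ### Soundness on one sub-box -/

/-- **Soundness of `boundsOnBox`**: `κlo ≤ κ₁,J · S` and `b_{J,R} · 4S ≤ bhi`, provided the table box contains the lookups
(`R + 1 ≤ K`) in their sound region (`R + 1 + J ≤ 2K + 1`). -/
theorem boundsOnBox_sound (hS : 0 < S) (hε : AForm.Valid ε) {M s₀ s₁ : ℝ} {FM F₀ F₁ : AForm}
    (hM : AForm.mem S ε M FM) (h₀ : AForm.mem S ε s₀ F₀) (h₁ : AForm.mem S ε s₁ F₁) {K J R : ℕ}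
    (hK : R + 1 ≤ K) (hJ : R + 1 + J ≤ 2 * K + 1) {κlo : ℤ} {bhi : ℕ}
    (h : boundsOnBox S K J R FM F₀ F₁ = some (κlo, bhi)) :
    (κlo : ℝ) ≤ kappaOne M s₀ s₁ J * S ∧ bubbleAbs M s₀ s₁ J R * (4 * S) ≤ bhi := by
  unfold boundsOnBox at h
  split at h
  · simp at h
  · rename_i nI hnI
    simp only [Option.some.injEq, Prod.mk.injEq] at h
    obtain ⟨hκ, hb⟩ := h
    have hn := nInvCM_sound S hS ε hε M s₀ s₁ FM F₀ F₁ nI hM h₀ h₁ hnI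
    have hg : ∀ a b : ℤ, |a| ≤ R + 1 → |b| ≤ R + 1 →
        CM.mem S ε (propTrunc M s₀ s₁ J (a, b)) (tabGet K (propTable S K nI J).2 a b) :=
      fun a b ha hb => (propTable_sound S hS ε hε M s₀ s₁ nI hn K J a b (by omega) (by omega)
        (by omega) (by omega)).2
    constructor
    · subst hκ
      have hm := CM.mem_trace (applyBlock_sound_true hε (hg 1 0 (by rw [abs_one]; omega) (by rw [abs_zero]; omega)) 1)
      rw [Int.cast_one, one_smul] at hm
      have hr := AForm.le_hi hε hm.1
      unfold AForm.hi at hr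
      unfold kappaOne
      push_cast at hr ⊢
      linarith
    · subst hb
      unfold bubbleAbs
      simp only [cellLinks, nearLinks_eq, linkBlocks_eq, List.map_map, Function.comp_def]
      rw [show ∀ X : ℝ, 1 / 4 * X * (4 * S) = X * S from fun X => by ring]
      refine sum_mul_le_natSum _ _ _ _ fun l _ => ?_
      refine sum_mul_le_natSum _ _ _ _ fun b₂ hb₂ => ?_
      refine sum_mul_le_natSum _ _ _ _ fun l' hl' => ?_
      refine sum_mul_le_natSum _ _ _ _ fun b₁ hb₁ => ?_
      have p₂ := mem_linkBlocksE hb₂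
      have p₁ := mem_linkBlocksE hb₁
      have pn := mem_nearLinksE hl'
      have a₁ := le_abs_self (l'.1 - l.1)
      have a₂ := neg_abs_le (l'.1 - l.1)
      have a₃ := le_abs_self (l'.2 - l.2)
      have a₄ := neg_abs_le (l'.2 - l.2)
      have m₁ := hg (b₂.2.1.1 - b₁.1.1) (b₂.2.1.2 - b₁.1.2) (by rw [abs_le]; constructor <;> omega)
        (by rw [abs_le]; constructor <;> omega)
      have m₂ := hg (b₁.2.1.1 - b₂.1.1) (b₁.2.1.2 - b₂.1.2) (by rw [abs_le]; constructor <;> omega)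
        (by rw [abs_le]; constructor <;> omega)
      have hm := CM.mem_trace (CM.mem_mul hS hε (applyBlock_sound hε m₁ b₁.2.2.1 b₁.2.2.2)
        (applyBlock_sound hε m₂ b₂.2.2.1 b₂.2.2.2))
      have ha := absUpper_sound hε hm
      simpa only [Matrix.mul_assoc] using ha

/-! ### The box cover -/

/-- A point within `w` of `c` lies in `boxVar S c w j` for a noise value `|t| ≤ 1` on symbol `j`. -/
theorem boxVar_sound (hS : 0 < S) {x : ℝ} {c w : ℚ} (h : |x - c| ≤ w) (j : ℕ) :
    ∃ t : ℝ, |t| ≤ 1 ∧ ∀ ε : ℕ → ℝ, ε j = t → AForm.mem S ε x (boxVar S c w j) := by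
  have hS' : (0 : ℝ) < S := by exact_mod_cast hS
  have hw0 : (0 : ℝ) ≤ w := (abs_nonneg _).trans h
  have hw0' : (0 : ℚ) ≤ w := by exact_mod_cast hw0
  have hceil : (w : ℝ) * S ≤ ((⌈w * S⌉ : ℤ) : ℝ) := by
    have h1 : w * (S : ℚ) ≤ ⌈w * (S : ℚ)⌉ := Int.le_ceil _
    exact_mod_cast h1
  have hfl1 : ((⌊c * S⌋ : ℤ) : ℝ) ≤ c * S := by
    have h1 : (⌊c * (S : ℚ)⌋ : ℚ) ≤ c * S := Int.floor_le _
    exact_mod_cast h1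
  have hfl2 : (c : ℝ) * S < ((⌊c * S⌋ : ℤ) : ℝ) + 1 := by
    have h1 : c * (S : ℚ) < ⌊c * (S : ℚ)⌋ + 1 := Int.lt_floor_add_one _
    exact_mod_cast h1
  by_cases hz : (⌈w * (S : ℚ)⌉ : ℤ) = 0
  · refine ⟨0, by simp, fun ε hε => ?_⟩
    have hw : (w : ℝ) ≤ 0 := by
      rw [hz, Int.cast_zero] at hceil
      exact le_of_mul_le_mul_right (by rw [zero_mul]; exact hceil) hS'
    have hxc : x = c := by
      have h1 : |x - c| ≤ 0 := h.trans hw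
      linarith [abs_nonneg (x - c), abs_eq_zero.1 (le_antisymm h1 (abs_nonneg _))]
    unfold AForm.mem boxVar
    simp only
    rw [AForm.lin_replicate_append, hε, hz, hxc, abs_le]
    push_cast
    constructor <;> linarith
  · have hWpos : (0 : ℝ) < ((⌈w * (S : ℚ)⌉ : ℤ) : ℝ) := by
      have hW0 : (0 : ℤ) ≤ ⌈w * (S : ℚ)⌉ := Int.ceil_nonneg (by positivity)
      have h1 : (0 : ℤ) < ⌈w * (S : ℚ)⌉ := lt_of_le_of_ne hW0 (Ne.symm hz)
      exact_mod_cast h1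
    refine ⟨(x - c) * S / ⌈w * (S : ℚ)⌉, ?_, fun ε hε => ?_⟩
    · rw [abs_div, abs_of_pos hWpos, div_le_one hWpos, abs_mul, abs_of_pos hS']
      calc |x - c| * S ≤ w * S := by gcongr
        _ ≤ _ := hceil
    · unfold AForm.mem boxVar
      simp only
      rw [AForm.lin_replicate_append, hε]
      have e : ((⌈w * (S : ℚ)⌉ : ℤ) : ℝ) * ((x - c) * S / ⌈w * (S : ℚ)⌉) = (x - c) * S := by
        field_simp
      rw [e, abs_le]
      push_cast
      constructor <;> linarith

/-- Every point of `[lo, lo + 2wn]` is within `w` of one of the `n` centres `lo + (2i+1)w`. -/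
theorem cover_index {x lo w : ℝ} {n : ℕ} (hn : 0 < n) (hw : 0 < w) (hlo : lo ≤ x) (hhi : x ≤ lo + 2 * w * n) :
    ∃ i : ℕ, i < n ∧ |x - (lo + (2 * i + 1) * w)| ≤ w := by
  set t : ℝ := (x - lo) / (2 * w) with ht
  have ht0 : 0 ≤ t := div_nonneg (by linarith) (by linarith)
  have htn : t ≤ n := by rw [ht, div_le_iff₀ (by linarith)]; linarith
  have hx : x = lo + 2 * w * t := by rw [ht]; field_simp; ring
  rcases lt_or_ge t n with hlt | hge
  · refine ⟨⌊t⌋₊, (Nat.floor_lt ht0).2 hlt, ?_⟩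
    have h1 := Nat.floor_le ht0
    have h2 := Nat.lt_floor_add_one t
    have k1 : 0 ≤ w * (t - ⌊t⌋₊) := mul_nonneg hw.le (by linarith)
    have k2 : w * (t - ⌊t⌋₊) ≤ w := mul_le_of_le_one_right hw.le (by linarith)
    rw [hx, abs_le]
    constructor <;> linarith
  · refine ⟨n - 1, by omega, ?_⟩
    have htn' : t = n := le_antisymm htn hge
    have hcast : ((n - 1 : ℕ) : ℝ) = n - 1 := by rw [Nat.cast_sub (by omega), Nat.cast_one]
    rw [hx, htn', hcast, abs_le]
    constructor <;> linarith

/-- **Soundness of the checker** (general truncation orders): if every sub-box of the standard cover passes, the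
truncated tadpole beats the truncated absolute bubble bound by `1/4000` on the heavy box. -/
theorem cellKappaCheck_sound {S K J R nM ns : ℕ} (hS : 0 < S) (hnM : 0 < nM) (hns : 0 < ns) (hK : R + 1 ≤ K)
    (hJ : R + 1 + J ≤ 2 * K + 1) (hcheck : cellKappaCheck S K J R nM ns = true) {M s₀ s₁ : ℝ}
    (hM1 : 589 / 100 ≤ M) (hM2 : M ≤ 61 / 10) (hs₀ : |s₀| ≤ 1 / 10) (hs₁ : |s₁| ≤ 1 / 10) :
    1 / 4000 ≤ kappaOne M s₀ s₁ J - bubbleAbs M s₀ s₁ J R := by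
  have hS' : (0 : ℝ) < S := by exact_mod_cast hS
  set wM : ℚ := (61 / 10 - 589 / 100) / (2 * nM) with hwM
  set ws : ℚ := (1 / 10) / ns with hws
  have hwMq : (0 : ℚ) < wM := by rw [hwM]; positivity
  have hwsq : (0 : ℚ) < ws := by rw [hws]; positivity
  have hwMpos : (0 : ℝ) < wM := by exact_mod_cast hwMq
  have hwspos : (0 : ℝ) < ws := by exact_mod_cast hwsq
  have hnM' : (nM : ℝ) ≠ 0 := by exact_mod_cast hnM.ne'
  have hns' : (ns : ℝ) ≠ 0 := by exact_mod_cast hns.ne'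
  have eM : (2 : ℝ) * wM * nM = 61 / 10 - 589 / 100 := by
    rw [hwM]; push_cast; field_simp
  have es : (2 : ℝ) * ws * ns = 1 / 10 - (-1 / 10) := by
    rw [hws]; push_cast; field_simp; norm_num
  rw [abs_le] at hs₀ hs₁
  obtain ⟨i, hi, hiM⟩ := cover_index (x := M) (lo := 589 / 100) hnM hwMpos hM1 (by rw [eM]; linarith)
  obtain ⟨k, hk, hk0⟩ := cover_index (x := s₀) (lo := -1 / 10) hns hwspos (by linarith) (by rw [es]; linarith)
  obtain ⟨l, hl, hl1⟩ := cover_index (x := s₁) (lo := -1 / 10) hns hwspos (by linarith) (by rw [es]; linarith)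
  -- the sub-box and its check
  set B : SubBox := ⟨589 / 100 + (2 * i + 1) * wM, wM, -1 / 10 + (2 * k + 1) * ws, ws,
    -1 / 10 + (2 * l + 1) * ws, ws⟩
  have hBmem : B ∈ subBoxes nM ns := by
    unfold subBoxes
    simp only [List.mem_flatMap, List.mem_map, List.mem_range, List.bind_eq_flatMap, List.pure_def,
      List.mem_cons, List.not_mem_nil, or_false]
    exact ⟨i, ⟨i, hi, rfl⟩, k, ⟨k, hk, rfl⟩, l, ⟨l, hl, rfl⟩, rfl⟩
  have hcB : checkSubBox S K J R B = true := by
    unfold cellKappaCheck at hcheck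
    exact List.all_eq_true.1 hcheck B hBmem
  unfold checkSubBox at hcB
  split at hcB
  · exact absurd hcB Bool.false_ne_true
  · rename_i κlo bhi hbounds
    have hdec : (S : ℤ) ≤ 1000 * (4 * κlo - bhi) := of_decide_eq_true hcB
    -- the noise values of the point in the sub-box
    have hcM : |M - ((589 / 100 + (2 * i + 1) * wM : ℚ) : ℝ)| ≤ (wM : ℚ) := by push_cast; exact hiM
    have hc0 : |s₀ - ((-1 / 10 + (2 * k + 1) * ws : ℚ) : ℝ)| ≤ (ws : ℚ) := by push_cast; exact hk0
    have hc1 : |s₁ - ((-1 / 10 + (2 * l + 1) * ws : ℚ) : ℝ)| ≤ (ws : ℚ) := by push_cast; exact hl1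
    obtain ⟨t₀, ht₀, hm₀⟩ := boxVar_sound hS hcM 0
    obtain ⟨t₁, ht₁, hm₁⟩ := boxVar_sound hS hc0 1
    obtain ⟨t₂, ht₂, hm₂⟩ := boxVar_sound hS hc1 2
    let ε : ℕ → ℝ := fun j => if j = 0 then t₀ else if j = 1 then t₁ else if j = 2 then t₂ else 0
    have hε : AForm.Valid ε := by
      intro j
      simp only [ε]
      split_ifs
      · exact ht₀
      · exact ht₁
      · exact ht₂
      · simp
    have hb := boundsOnBox_sound hS hε (hm₀ ε (by simp [ε])) (hm₁ ε (by simp [ε])) (hm₂ ε (by simp [ε])) hK hJ hbounds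
    have hdec' : (S : ℝ) ≤ 1000 * (4 * (κlo : ℝ) - (bhi : ℝ)) := by exact_mod_cast hdec
    have key : 1 / 4000 * (S : ℝ) ≤ (kappaOne M s₀ s₁ J - bubbleAbs M s₀ s₁ J R) * S := by
      linarith [hb.1, hb.2]
    exact le_of_mul_le_mul_right key hS'

/-- **The certified claim from the checker** (registered helper): if `cellKappaCheck S K 14 7 nM ns` accepts (any scale
`S > 0`, any cover `nM, ns > 0`, table half-width `K ≥ 11`), then `CellKappaClaim` holds. -/
theorem cellKappaClaim_of_check : ∀ (S K nM ns : ℕ), 0 < S → 0 < nM → 0 < ns → 11 ≤ K → cellKappaCheck S K 14 7 nM ns = true → CellKappaClaim := by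
  intro S K nM ns hS hnM hns hK hcheck M s₀ s₁ hM1 hM2 hs₀ hs₁
  exact cellKappaCheck_sound hS hnM hns (by omega) (by omega) hcheck hM1 hM2 hs₀ hs₁

end Summit.QuantumFields.QCD.Cruxes.CriticalLineDiamagnetism.ChessboardCellGain.CellKappa
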